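import Summits.RiemannHypothesis.RiemannHypothesis.Theorems.GroundBartaEvenWinsBeyondArchDeflationWindowImageSplit
import Literature.Analysis.ValidatedNumerics.TaylorModelMovingIntegral
import Literature.Analysis.ValidatedNumerics.ExpPoly.SecondDifference
import Literature.NumberTheory.LFunctions.WeilArchDensityPanels
import HarnessLib

/-!
# RiemannHypothesis / GroundBarta — rung 4 (`EvenWinsBeyondArch`, stmt-RiemannHypothesis-18807 / 18085):
# the deflated Temple L-side, XVI — the ARCHIMEDEAN part of the window image as a per-panel Taylor model

Helper file (`--supports stmt-RiemannHypothesis-18807`), RH-free, Mathlib + landed tree files only, no facts.  Prover B,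
speedrun unit `sr-gb-rung-b` (gen 4).

File XIV split the archimedean layer of the window image of `𝟙_{[-c,c]}·g` at `0 ≤ y < c` into
`∫_{(0,c−y]} G·E + ∫_{(c−y,c+y]} G·H + g(y)(Ψ(c−y) + Ψ(c+y))`.  On the y-panel `k` (`y = y_k + ρ`, `y_k = (2k+1)h`, `h = c/(2m)`,
`|ρ| ≤ h`) the endpoints `c ∓ y = t_{m−1−k} − ρ`, `t_{m+k} + ρ` move inside the t-panels `m−1−k` and `m+k` of the SAME grid, and
`E`, `H` are the exact bivariate polynomials of `ExpPoly/SecondDifference.lean`.  Hence, GIVEN Taylor models of `G = weilArchDensityG`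
on the t-panels `0, …, 2m−1` (data `D : List (IPoly × Poly)`, hypothesis `hD`; produced by `WeilArchDensityPanels` / `TaylorModelPhi`
technology, prover A), the kernel-computable interval polynomial `dt_archSplitTM` (built from `movingIntegBTM` of
`TaylorModelMovingIntegral.lean`) ENCLOSES the two regular integrals as a function of `ρ` (`dt_tmem_archSplitTM`).  The remaining
term `g(y)(Ψ(c−y)+Ψ(c+y))`, the pole, prime and polynomial terms are Taylor-modelled by the same generic tools (files to follow);
together they give the per-panel residual TM consumed by `dt_residual_normSq_le_of_panels` (file XV) through `integral_sq_le_sqIntegUpperQ`.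

References: E. Bombieri, Rend. Mat. Acc. Lincei (9) 11 (2000) Thm 2 [Bombieri2000Weil]; K. Makino, M. Berz (2003) (Taylor models).
-/

set_option linter.dupNamespace false

noncomputable section

open MeasureTheory Set Filter
open scoped Topology BigOperators Interval

namespace Summit.RiemannHypothesis.RiemannHypothesis.Theorems.EvenWinsBeyondArch

open Literature.NumberTheory.LFunctions
open Literature.Analysis.ValidatedNumerics Literature.Analysis.ValidatedNumerics.PolyMP
  Literature.Analysis.ValidatedNumerics.ExpPoly

/-! ## The kernel object -/

/-- **Per-panel Taylor model of the two regular archimedean integrals** of the window image of `𝟙_{[-c,c]}·g` on y-panel `k`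
(variable `ρ = y − y_k`): `∫_0^{t_{m−1−k} − ρ} G·E_k(ρ,·) + (∫_0^{t_{m+k}+ρ} − ∫_0^{t_{m−1−k}−ρ}) G·H_k(ρ,·)`, from the t-panel data `D`
of `G` (entry `j` = Taylor model and reference polynomial of `u ↦ G(t_j + u)`), truncation degree `Dg`. -/
def dt_archSplitTM (S : ℕ) (c : ℚ) (m Dg : ℕ) (D : List (IPoly × Poly)) (gp : Poly) (k : ℕ) : IPoly :=
  let h : ℚ := c / (2 * m)
  let jn : ℕ := m - 1 - k
  let jf : ℕ := m + k
  let y0 : ℚ := panelCentre h k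
  let near : BPoly → IPoly := fun Q ↦
    movingIntegBTM S h Dg (D.take jn) (D.getD jn ([], [])).1 (D.getD jn ([], [])).2 true Q
  let far : BPoly → IPoly := fun Q ↦
    movingIntegBTM S h Dg (D.take jf) (D.getD jf ([], [])).1 (D.getD jf ([], [])).2 false Q
  taddI (near (secondDiffQuot gp y0)) (tsubI (far (firstDiffQuot gp y0)) (near (firstDiffQuot gp y0)))

/-! ## Index bookkeeping on the common grid -/

/-- `t_{m−1−k} = c − y_k` on the grid `h = c/(2m)`, `k < m`. -/
theorem dt_panelCentre_near {c : ℚ} {m k : ℕ} (hk : k < m) :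
    ((panelCentre (c / (2 * m)) (m - 1 - k) : ℚ) : ℝ) = (c : ℝ) - (panelCentre (c / (2 * m)) k : ℚ) := by
  have hm : (m : ℝ) ≠ 0 := by
    have : 0 < m := Nat.zero_lt_of_lt hk
    positivity
  have hsub : ((m - 1 - k : ℕ) : ℚ) = (m : ℚ) - 1 - k := by
    rw [Nat.sub_sub, Nat.cast_sub (by omega)]; push_cast; ring
  simp only [panelCentre, hsub]
  push_cast
  field_simp
  ring

/-- `t_{m+k} = c + y_k` on the grid `h = c/(2m)`. -/
theorem dt_panelCentre_far {c : ℚ} {m k : ℕ} (hm : 0 < m) :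
    ((panelCentre (c / (2 * m)) (m + k) : ℚ) : ℝ) = (c : ℝ) + (panelCentre (c / (2 * m)) k : ℚ) := by
  have hm' : (m : ℝ) ≠ 0 := by positivity
  simp only [panelCentre]
  push_cast
  field_simp
  ring

/-- Taylor-model hypotheses restrict to an initial segment of the panel data. -/
theorem dt_tmem_take {S : ℕ} {h : ℚ} {w : ℝ → ℝ} {D : List (IPoly × Poly)}
    (hD : ∀ i : Fin D.length, TMem S h (fun u ↦ w ((panelCentre h i : ℝ) + u)) (D.get i).1) (n : ℕ) :
    ∀ i : Fin (D.take n).length, TMem S h (fun u ↦ w ((panelCentre h i : ℝ) + u)) ((D.take n).get i).1 := by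
  intro i
  have hi : (i : ℕ) < D.length := by
    have := i.2; simp only [List.length_take] at this; omega
  have e : (D.take n).get i = D.get ⟨i, hi⟩ := by
    simp [List.get_eq_getElem, List.getElem_take]
  rw [e]
  exact hD ⟨i, hi⟩

/-! ## Soundness -/

/-- **The archimedean regular integrals of the window image, enclosed per panel.**  Let `0 < c`, `0 < m`, `h = c/(2m)`, `k < m`,
`y_k = (2k+1)h`; let `D` (length `2m`) carry Taylor models of `u ↦ G(t_j + u)` on `|u| ≤ h` for every t-panel `j < 2m`; let the
divided-difference checks of `g` at `y_k` pass.  Then for `|ρ| ≤ h`, with `y = y_k + ρ` and `g = Poly.eval gp`,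
`∫_{(0,c−y]} G(t)(2g(y)−g(y−t)−g(y+t))/t dt + ∫_{(c−y,c+y]} G(t)(g(y)−g(y−t))/t dt` lies in `dt_archSplitTM S c m Dg D gp k` at `ρ`.
[cite: Bombieri2000Weil, Thm 2 (the archimedean density)] -/
theorem dt_tmem_archSplitTM {S : ℕ} (hS : 0 < S) {c : ℚ} (hc : 0 < c) {m : ℕ} (hm : 0 < m) (Dg : ℕ)
    (D : List (IPoly × Poly)) (hDl : D.length = 2 * m)
    (hD : ∀ i : Fin D.length,
      TMem S (c / (2 * m)) (fun u ↦ weilArchDensityG ((panelCentre (c / (2 * m)) i : ℝ) + u)) (D.get i).1)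
    (gp : Poly) {k : ℕ} (hk : k < m)
    (hE : secondDiffCheck gp (panelCentre (c / (2 * m)) k) = true)
    (hH : firstDiffCheck gp (panelCentre (c / (2 * m)) k) = true) :
    TMem S (c / (2 * m)) (fun ρ ↦
      (∫ t in Ioc 0 ((c : ℝ) - ((panelCentre (c / (2 * m)) k : ℚ) + ρ)),
        weilArchDensityG t * ((2 * Poly.eval gp ((panelCentre (c / (2 * m)) k : ℚ) + ρ) -
          Poly.eval gp ((panelCentre (c / (2 * m)) k : ℚ) + ρ - t) -
          Poly.eval gp ((panelCentre (c / (2 * m)) k : ℚ) + ρ + t)) / t)) +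
      ∫ t in Ioc ((c : ℝ) - ((panelCentre (c / (2 * m)) k : ℚ) + ρ)) ((c : ℝ) + ((panelCentre (c / (2 * m)) k : ℚ) + ρ)),
        weilArchDensityG t * ((Poly.eval gp ((panelCentre (c / (2 * m)) k : ℚ) + ρ) -
          Poly.eval gp ((panelCentre (c / (2 * m)) k : ℚ) + ρ - t)) / t))
      (dt_archSplitTM S c m Dg D gp k) := by
  set h : ℚ := c / (2 * m) with hh
  set jn : ℕ := m - 1 - k with hjn
  set jf : ℕ := m + k with hjf
  set y0 : ℚ := panelCentre h k with hy0
  have hmq : (0 : ℚ) < m := by exact_mod_cast hm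
  have hh0 : 0 ≤ h := by rw [hh]; positivity
  have hhr : (0 : ℝ) ≤ h := by exact_mod_cast hh0
  have hjnD : jn < D.length := by rw [hDl]; omega
  have hjfD : jf < D.length := by rw [hDl]; omega
  have hwi : ∀ a b : ℝ, 0 ≤ a → a ≤ b → IntervalIntegrable weilArchDensityG volume a b :=
    fun a b ha hab ↦ intervalIntegrable_weilArchDensityG ha hab
  -- panel data for the partial panels
  have hlen_n : (D.take jn).length = jn := List.length_take_of_le hjnD.le
  have hlen_f : (D.take jf).length = jf := List.length_take_of_le hjfD.le
  have hget_n : D.getD jn ([], []) = D.get ⟨jn, hjnD⟩ := List.getD_eq_get _ ([], []) ⟨jn, hjnD⟩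
  have hget_f : D.getD jf ([], []) = D.get ⟨jf, hjfD⟩ := List.getD_eq_get _ ([], []) ⟨jf, hjfD⟩
  have hWn : TMem S h (fun u ↦ weilArchDensityG ((panelCentre h (D.take jn).length : ℝ) + u)) (D.getD jn ([], [])).1 := by
    rw [hlen_n, hget_n]; exact hD ⟨jn, hjnD⟩
  have hWf : TMem S h (fun u ↦ weilArchDensityG ((panelCentre h (D.take jf).length : ℝ) + u)) (D.getD jf ([], [])).1 := by
    rw [hlen_f, hget_f]; exact hD ⟨jf, hjfD⟩
  -- the three moving integrals
  have hE1 := tmem_movingIntegBTM hS hh0 Dg hwi (D.take jn) (dt_tmem_take hD jn) hWn (D.getD jn ([], [])).2 true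
    (secondDiffQuot gp y0)
  have hH1 := tmem_movingIntegBTM hS hh0 Dg hwi (D.take jf) (dt_tmem_take hD jf) hWf (D.getD jf ([], [])).2 false
    (firstDiffQuot gp y0)
  have hH2 := tmem_movingIntegBTM hS hh0 Dg hwi (D.take jn) (dt_tmem_take hD jn) hWn (D.getD jn ([], [])).2 true
    (firstDiffQuot gp y0)
  rw [hlen_n] at hE1 hH2
  rw [hlen_f] at hH1
  have hsum := tmem_add hE1 (tmem_sub hH1 hH2)
  -- geometry of the grid
  have hnear : ((panelCentre h jn : ℚ) : ℝ) = (c : ℝ) - (y0 : ℝ) := by rw [hjn, hy0, hh]; exact dt_panelCentre_near hk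
  have hfar : ((panelCentre h jf : ℚ) : ℝ) = (c : ℝ) + (y0 : ℝ) := by rw [hjf, hy0, hh]; exact dt_panelCentre_far hm
  have hy0v : ((y0 : ℚ) : ℝ) = (2 * (k : ℝ) + 1) * (h : ℝ) := by rw [hy0]; simp [panelCentre]
  have hmr : (m : ℝ) ≠ 0 := by positivity
  have hch : (c : ℝ) = 2 * (m : ℝ) * (h : ℝ) := by
    rw [hh]; push_cast; field_simp
  intro ρ hρ
  obtain ⟨as, has, e⟩ := hsum ρ hρ
  refine ⟨as, has, ?_⟩
  rw [← e]
  simp only [↓reduceIte, Bool.false_eq_true]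
  have hρ' := abs_le.1 hρ
  have hk1 : (k : ℝ) + 1 ≤ m := by exact_mod_cast hk
  have hk0 : (0 : ℝ) ≤ k := by exact_mod_cast Nat.zero_le k
  -- `0 ≤ c − y ≤ c + y`
  have hL0 : 0 ≤ (c : ℝ) - ((y0 : ℝ) + ρ) := by rw [hy0v, hch]; nlinarith
  have hy0ρ : 0 ≤ (y0 : ℝ) + ρ := by rw [hy0v]; nlinarith
  have hLU : (c : ℝ) - ((y0 : ℝ) + ρ) ≤ (c : ℝ) + ((y0 : ℝ) + ρ) := by linarith
  -- first integral: `Ioc 0 (c−y)` of the divided second difference = `∫_0^{t_jn − ρ}` of `G · E_k`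
  have e1 : ∫ t in Ioc 0 ((c : ℝ) - ((y0 : ℝ) + ρ)),
      weilArchDensityG t * ((2 * Poly.eval gp ((y0 : ℝ) + ρ) - Poly.eval gp ((y0 : ℝ) + ρ - t) -
        Poly.eval gp ((y0 : ℝ) + ρ + t)) / t) =
      ∫ t in (0 : ℝ)..((panelCentre h jn : ℝ) + -ρ), weilArchDensityG t * BPoly.eval (secondDiffQuot gp y0) t ρ := by
    rw [hnear, ← sub_eq_add_neg, show (c : ℝ) - (y0 : ℝ) - ρ = (c : ℝ) - ((y0 : ℝ) + ρ) by ring,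
      intervalIntegral.integral_of_le hL0]
    refine setIntegral_congr_fun measurableSet_Ioc fun t ht ↦ ?_
    rw [eval_secondDiffQuot_eq_div hE ht.1.ne']
  -- second integral: `Ioc (c−y) (c+y)` of the divided first difference = `∫_0^{t_jf+ρ} − ∫_0^{t_jn−ρ}` of `G · H_k`
  have hIH : ∀ T : ℝ, 0 ≤ T →
      IntervalIntegrable (fun t ↦ weilArchDensityG t * BPoly.eval (firstDiffQuot gp y0) t ρ) volume 0 T :=
    fun T hT ↦ intervalIntegrable_weilArchDensityG_mul le_rfl hT (continuous_beval_fst ρ _)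
  have e2 : ∫ t in Ioc ((c : ℝ) - ((y0 : ℝ) + ρ)) ((c : ℝ) + ((y0 : ℝ) + ρ)),
      weilArchDensityG t * ((Poly.eval gp ((y0 : ℝ) + ρ) - Poly.eval gp ((y0 : ℝ) + ρ - t)) / t) =
      (∫ t in (0 : ℝ)..((panelCentre h jf : ℝ) + ρ), weilArchDensityG t * BPoly.eval (firstDiffQuot gp y0) t ρ) -
        ∫ t in (0 : ℝ)..((panelCentre h jn : ℝ) + -ρ), weilArchDensityG t * BPoly.eval (firstDiffQuot gp y0) t ρ := by
    rw [hnear, hfar, ← sub_eq_add_neg, show (c : ℝ) - (y0 : ℝ) - ρ = (c : ℝ) - ((y0 : ℝ) + ρ) by ring,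
      show (c : ℝ) + (y0 : ℝ) + ρ = (c : ℝ) + ((y0 : ℝ) + ρ) by ring,
      intervalIntegral.integral_interval_sub_left (hIH _ (hL0.trans hLU)) (hIH _ hL0),
      intervalIntegral.integral_of_le hLU]
    refine setIntegral_congr_fun measurableSet_Ioc fun t ht ↦ ?_
    rw [eval_firstDiffQuot_eq_div hH (hL0.trans_lt ht.1).ne']
  rw [e1, e2]

end Summit.RiemannHypothesis.RiemannHypothesis.Theorems.EvenWinsBeyondArch

end
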